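import Literature.Barriers.QuantumAdvantage.SupremacyTheoremsNonRelativizing
import Literature.Computability.Cryptography.OracleAdversaryFPRel
import Literature.Computability.Cryptography.SamplingProblemsUniform
import Literature.Computability.Complexity.OracleEmptyFP
import Literature.Computability.Complexity.OracleProofs
import Literature.Computability.Complexity.PairingMachines
import HarnessLib

/-!
# `SampBPP^∅ = UniformSampP`: the corrected form of the bridge fact `SampPRel_empty`, proved

Companion of `SupremacyTheoremsNonRelativizing.lean` (barrier catalogue `QuantumAdvantage`; the
relativized sampling class `SampPRel O = SampBPP^O` of Aaronson–Chen 2017, Def. 2.3) and of its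
sibling `SupremacyTheoremsNonRelativizingSampPRel.lean`. The former vendors the model-bridging
named fact

* `SampPRel_empty : Prop := SampPRel Oracle.empty = SampP` ([folklore], used nowhere),

and the latter REFUTES it (`not_SampPRel_empty`, from `sampPRel_countable` and
`not_countable_sampP`): the tree's `SampP` (`Cryptography/SamplingProblems.lean`) quantifies over
`RandAlg`s with `IsPPT A id`, which only *bounds* the coin budget `A.coinLen : ℕ → ℕ` (otherwise
arbitrary data, readable by `A.run` off the length of its coin string — advice), so it is
uncountable, whereas `SampPRel O` is a class of uniform machines (an `OracleAdversary` carries a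
polynomial-time step function and literal polynomials `coins`, `fuel`) and is countable.

**This file vendors and PROVES the corrected statement** — the one the source means
(Aaronson–Chen 2017, Def. 2.3, p. 12: "`SampBPP` is the class of sampling problems … for which
there exists a probabilistic polynomial-time algorithm `B` that, given `⟨x, 0^{1/ε}⟩` as input,
samples from a probability distribution `𝒞_x` such that `‖𝒞_x − 𝒟_x‖ ≤ ε`. … Oracle versions of
these classes can also be defined in the natural way" — a class of UNIFORM machines;
Baker–Gill–Solovay 1975, §1: the empty oracle gives no power), with the tree's uniform class
`UniformSampP` of `SamplingProblemsUniform.lean` (`IsPPT A id` and an exactly polynomial coin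
budget, the cure already used for `SampP_subset_SampBQP` and quantum-advantage S20–S22):

* `SampPRel_empty_uniform : Prop := SampPRel Oracle.empty = UniformSampP`, discharged by
  `SampPRel_empty_uniform_holds` from the two inclusions `SampPRel_empty_subset_UniformSampP` and
  `UniformSampP_subset_SampPRel_empty`;
* corollary: `SampPRel_empty_subset_SampP` (the true half of the vendored equality; the false half,
  `SampP ⊄ SampPRel Oracle.empty`, is `sampPRel_ne_sampP` of the sibling file with this inclusion).

## The proofs

* `SampPRel ∅ ⊆ UniformSampP`: for a PPT adversary `𝒜`, the clocked run
  `w = ⟨y, r⟩ ↦ (𝒜.alg.run ∅ (fuel |y|) w).getD []` is in `FP^∅`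
  (`OracleAdversary.clockedRun_mem_FPRel`, `OracleAdversaryFPRel.lean`: against a one-bit oracle the
  queries of a polynomial-time step function stay polynomially short), hence in `FP`
  (`FPRel_empty_subset_FP`, `OracleEmptyFP.lean`: the clocked-iteration simulation of the empty
  oracle); the randomized algorithm "run this `FP` function on `⟨y, r⟩`" with coin budget
  `𝒜.coins` is `IsPPT` with an exactly polynomial budget, and its law on `⟨x, 1ᵏ⟩` *equals* the
  adversary's output law with `none ↦ []`.
* `UniformSampP ⊆ SampPRel ∅`: for a uniform sampler `A` with `A.coinLen = q`, the query-free oracle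
  algorithm `OracleAlg.ofFun (uncurry A.run ∘ boolUnpair)` (polynomial time by
  `OracleAlg.isPolyTime_ofFun_holds`, `PolyTimeComputable.comp_holds` and the re-pairing machine
  `polyTimeComputable_boolUnpair`) with coin budget `q` and round budget `1` outputs, on `⟨y, r⟩`,
  `some (A.run y r)` in its single round; its law with `none ↦ []` *equals* `A.samplePMF x k`
  (transport along `A.coinLen = q`).

Nothing here modifies `SupremacyTheoremsNonRelativizing.lean`; `SampPRel_empty` is left as
vendored (no dependents), refuted in the sibling file and corrected here. This file does not import
the sibling (it needs nothing from it); both can be imported together (disjoint names).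

## References

* S. Aaronson, L. Chen, *Complexity-theoretic foundations of quantum supremacy experiments*,
  CCC 2017 (arXiv:1612.05903), Def. 2.3 (p. 12) [AaronsonChen2017].
* T. Baker, J. Gill, R. Solovay, *Relativizations of the P =? NP question*, SIAM J. Comput. 4
  (1975), §1 (the empty oracle) [BakerGillSolovay1975].
* S. Arora, B. Barak, *Computational Complexity: A Modern Approach*, CUP 2009, Def. 7.1 (coins of a
  PTM), §3.4 (oracle machines), Def. 6.5 (advice), §1.4 (machines as strings) [AroraBarakCC2009].
-/

noncomputable section

namespace Literature.Barriers.QuantumAdvantage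

open _root_.Computability Literature.Computability.Complexity Literature.Computability.Complexity.Classes Literature.Computability.Cryptography

/-! ### `SampBPP^∅ = UniformSampP` -/

/-- Uniform coin strings of equal prescribed lengths have the same law under any read-out
(transport along an equality of coin budgets). [folklore] -/
private theorem map_uniformVector_congr {β : Type} {m m' : ℕ} (h : m = m') (g : List Bool → β) :
    (PMF.uniformOfFintype (List.Vector Bool m)).map (fun r => g r.toList) =
      (PMF.uniformOfFintype (List.Vector Bool m')).map (fun r => g r.toList) := by
  subst h
  rfl

/-- A query-free oracle algorithm outputs within one round. [folklore] -/
private theorem run_ofFun_one {β : Type} (f : List Bool → β) (O : Oracle) (w : List Bool) :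
    (OracleAlg.ofFun f).run O 1 w = some (f w) :=
  rfl

/-- **`SampBPP^∅ ⊆ UniformSampP`**: a PPT oracle adversary with the empty oracle is simulated, law
for law, by a uniform randomized algorithm — its clocked run `⟨y, r⟩ ↦ (𝒜.alg.run ∅ (fuel |y|) ⟨y, r⟩).getD []`
is an `FP^∅` function (`OracleAdversary.clockedRun_mem_FPRel`), hence an `FP` function
(`FPRel_empty_subset_FP`: the empty oracle gives no power), run with the adversary's own polynomial
coin budget. [cite: BakerGillSolovay1975, §1 (the empty oracle)] [cite: AaronsonChen2017, Def. 2.3 (p. 12)] -/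
theorem SampPRel_empty_subset_UniformSampP : SampPRel Oracle.empty ⊆ UniformSampP := by
  rintro D ⟨𝒜, h𝒜, hD⟩
  have hgFP : (fun w => (𝒜.alg.run (Oracle.ofLanguage 0)
      (𝒜.fuel.eval (boolUnpair w).1.length) w).getD []) ∈ FP :=
    FPRel_empty_subset_FP (OracleAdversary.clockedRun_mem_FPRel 𝒜 h𝒜 0)
  -- the simulating randomized algorithm: run the `FP` function on `⟨y, r⟩`, coin budget `coins`
  have hPPT : IsPPT (⟨fun y r => (fun w => (𝒜.alg.run (Oracle.ofLanguage 0)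
      (𝒜.fuel.eval (boolUnpair w).1.length) w).getD []) (boolPair y r), fun n => 𝒜.coins.eval n⟩ :
      RandAlg (List Bool) (List Bool)) id := by
    refine ⟨?_, 𝒜.coins, fun n => le_rfl⟩
    obtain ⟨p, M, hM⟩ := hgFP
    exact ⟨p, M, fun z => hM (boolPair z.1 z.2)⟩
  refine ⟨_, hPPT, ⟨𝒜.coins, fun n => rfl⟩, fun x k hk => ?_⟩
  have key : (⟨fun y r => (fun w => (𝒜.alg.run (Oracle.ofLanguage 0)
        (𝒜.fuel.eval (boolUnpair w).1.length) w).getD []) (boolPair y r), fun n => 𝒜.coins.eval n⟩ :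
        RandAlg (List Bool) (List Bool)).samplePMF x k =
      PMF.map (fun o => o.getD []) (𝒜.outputPMF Oracle.empty (boolPair x (unaryEncodeNat k))) := by
    rw [OracleAdversary.outputPMF_eq_map, PMF.map_comp]
    simp only [RandAlg.samplePMF, RandAlg.outputPMF, Function.comp_def, id, boolUnpair_boolPair]
    rfl
  rw [key]
  exact hD x k hk

/-- **`UniformSampP ⊆ SampBPP^∅`**: a uniform sampler `A` with coin budget `q` is the oracle
adversary with the query-free algorithm `OracleAlg.ofFun (uncurry A.run ∘ boolUnpair)` (polynomial
time: `OracleAlg.isPolyTime_ofFun_holds`, `PolyTimeComputable.comp_holds`,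
`polyTimeComputable_boolUnpair`), coin budget `q` and one round; on `⟨y, r⟩` it outputs
`some (A.run y r)`, so its law is `A.samplePMF x k`. [cite: AaronsonChen2017, Def. 2.3 (p. 12)]
[cite: AroraBarakCC2009, Def. 7.1 with §3.4] -/
theorem UniformSampP_subset_SampPRel_empty : UniformSampP ⊆ SampPRel Oracle.empty := by
  rintro D ⟨A, hA, ⟨q, hq⟩, hD⟩
  have hF : PolyTimeComputable (id : List Bool → List Bool) (id : List Bool → List Bool)
      (Function.uncurry A.run ∘ boolUnpair) :=
    PolyTimeComputable.comp_holds hA.1 polyTimeComputable_boolUnpair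
  refine ⟨⟨OracleAlg.ofFun (Function.uncurry A.run ∘ boolUnpair), q, 1⟩,
    OracleAlg.isPolyTime_ofFun_holds hF, fun x k hk => ?_⟩
  have key : PMF.map (fun o => o.getD [])
      ((⟨OracleAlg.ofFun (Function.uncurry A.run ∘ boolUnpair), q, 1⟩ :
          OracleAdversary (List Bool)).outputPMF Oracle.empty (boolPair x (unaryEncodeNat k))) =
        A.samplePMF x k := by
    rw [OracleAdversary.outputPMF_eq_map, PMF.map_comp]
    simp only [RandAlg.samplePMF, RandAlg.outputPMF, Polynomial.eval_one, run_ofFun_one,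
      Function.comp_apply, boolUnpair_boolPair, Function.uncurry_apply_pair, id]
    exact map_uniformVector_congr (hq _).symm (A.run (boolPair x (unaryEncodeNat k)))
  rw [key]
  exact hD x k hk

/-- **Corrected statement of `SampPRel_empty`: `SampBPP^∅ = UniformSampP`.** Relativizing the
sampling class to the empty oracle gives back the class of sampling problems approximately sampled
by UNIFORM probabilistic polynomial-time machines (Aaronson–Chen 2017, Def. 2.3: "a probabilistic
polynomial-time algorithm `B` that, given `⟨x, 0^{1/ε}⟩` as input, samples from a probability
distribution `𝒞_x` such that `‖𝒞_x − 𝒟_x‖ ≤ ε` … Oracle versions of these classes can also be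
defined in the natural way"; Baker–Gill–Solovay 1975, §1: the empty oracle gives no power) — the
tree's `UniformSampP` (`SamplingProblemsUniform.lean`), NOT the tree's advice-taking `SampP`.

Discrepancy with `SampPRel_empty` (`SupremacyTheoremsNonRelativizing.lean`, stated as
`SampPRel Oracle.empty = SampP`): the tree's `SampP` only bounds the coin budget of its `RandAlg`
witnesses (`IsPPT A id`), which makes it uncountable (`not_countable_sampP`), while `SampPRel O` is
countable (`sampPRel_countable`); so `SampPRel_empty` is false (`not_SampPRel_empty`,
`SupremacyTheoremsNonRelativizingSampPRel.lean`), and the faithful right-hand side is the uniform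
class, exactly as in the corrected forms `UniformSampP_subset_SampBQP` (for `SampP_subset_SampBQP`)
and quantum-advantage S20–S22. Proved below (`SampPRel_empty_uniform_holds`). [cite: AaronsonChen2017, Def. 2.3 (p. 12)]
[cite: BakerGillSolovay1975, §1 (the empty oracle)] -/
def SampPRel_empty_uniform : Prop :=
  SampPRel Oracle.empty = UniformSampP

/-- **Discharge of `SampPRel_empty_uniform`** (`SampPRel_empty_subset_UniformSampP` and
`UniformSampP_subset_SampPRel_empty`). [cite: AaronsonChen2017, Def. 2.3 (p. 12)]
[cite: BakerGillSolovay1975, §1 (the empty oracle)] -/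
theorem SampPRel_empty_uniform_holds : SampPRel_empty_uniform :=
  Set.Subset.antisymm SampPRel_empty_subset_UniformSampP UniformSampP_subset_SampPRel_empty

/-- The uniform class sits inside the tree's `SampP`, so `SampBPP^∅ ⊆ SampP` — the true half of the
vendored equality. [folklore] -/
theorem SampPRel_empty_subset_SampP : SampPRel Oracle.empty ⊆ SampP :=
  SampPRel_empty_subset_UniformSampP.trans UniformSampP_subset_SampP

end Literature.Barriers.QuantumAdvantage

end
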